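import Summits.AtomisticToContinuum.Crystallization.Theorems.ChargedEnergyGap.Negative.BlocksBound
import Literature.MathematicalPhysics.StatisticalMechanics.PeriodicConfigurationSums

/-!
# Periodic stability of the range-2 truncated Lennard-Jones potential

Stub `stub_periodicStability` of the line `frustration-free-census-germ` for the crux
`PricedLinkCensus.TruncatedCensusGap` (item stmt-AtomisticToContinuum-14230), registered by
`ledger skeleton check` on the skeleton `Cruxes/TruncatedCensusGap/Lines/frustration_free_census_germ.lean`.
The statement below is the registered signature VERBATIM (self-contained over tree declarations).

Route: `V_LJ ≤ V_χ` pointwise, both lattice sums summable, `tsum_le_tsum`, and the landed item 0714 `ChargedEnergyGapNegative.bddBelow_energyPerParticle_lennardJones`.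
-/

noncomputable section

namespace Summit.AtomisticToContinuum.Crystallization.Theorems.PricedLinkCensusTruncatedCensusGap

open scoped BigOperators
open Literature.MathematicalPhysics.StatisticalMechanics Literature.Geometry.DiscreteGeometry

/-- The cutoff `χ r = min 1 (max 0 (4 − 2r))` is non-negative. [folklore] -/
private theorem chi_nonneg (r : ℝ) : 0 ≤ min 1 (max 0 (4 - 2 * r)) :=
  le_min zero_le_one (le_max_left _ _)

/-- The cutoff `χ r = min 1 (max 0 (4 − 2r))` is at most `1`. [folklore] -/
private theorem chi_le_one (r : ℝ) : min 1 (max 0 (4 - 2 * r)) ≤ 1 :=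
  min_le_left _ _

/-- `V_LJ ≤ V_χ = χ · V_LJ` pointwise: `χ = 1` wherever `V_LJ > 0` (there `r < 1`), and
`χ ≤ 1` where `V_LJ ≤ 0`. [folklore] -/
private theorem lennardJones_le_chi_mul (r : ℝ) :
    lennardJones r ≤ min 1 (max 0 (4 - 2 * r)) * lennardJones r := by
  rcases le_or_gt (lennardJones r) 0 with h | h
  · have := mul_le_mul_of_nonpos_right (chi_le_one r) h
    simpa using this
  · rcases le_or_gt r (3 / 2) with hr | hr
    · have hχ : min 1 (max 0 (4 - 2 * r)) = 1 :=
        min_eq_left (le_max_of_le_right (by linarith))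
      rw [hχ, one_mul]
    · have : lennardJones r ≤ 0 := lennardJones_nonpos (by linarith)
      linarith

/-- `‖V_χ‖ ≤ |V_LJ|` pointwise, since `0 ≤ χ ≤ 1`. [folklore] -/
private theorem norm_chi_mul_le (r : ℝ) :
    ‖min 1 (max 0 (4 - 2 * r)) * lennardJones r‖ ≤ |lennardJones r| := by
  rw [Real.norm_eq_abs, abs_mul, abs_of_nonneg (chi_nonneg r)]
  exact mul_le_of_le_one_left (abs_nonneg _) (chi_le_one r)

/-- The `V_χ` lattice sum of a periodic configuration of `ℝ³` is summable (by comparison with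
the absolutely summable Lennard-Jones lattice sum). [folklore] -/
private theorem summable_chi_mul_dist (P : PeriodicConfiguration 3)
    (x : EuclideanSpace ℝ (Fin 3)) :
    Summable fun y : {y // y ∈ P.points ∧ y ≠ x} =>
      min 1 (max 0 (4 - 2 * dist x y.1)) * lennardJones (dist x y.1) :=
  (P.summable_lennardJones_dist_three x).abs.of_norm_bounded fun _ => norm_chi_mul_le _

/-- `e_LJ(Q) ≤ e_χ(Q)` for every periodic configuration `Q` of `ℝ³`. [folklore] -/
private theorem energyPerParticle_lennardJones_le (Q : PeriodicConfiguration 3) :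
    Q.energyPerParticle lennardJones ≤
      Q.energyPerParticle fun r => min 1 (max 0 (4 - 2 * r)) * lennardJones r := by
  unfold PeriodicConfiguration.energyPerParticle
  refine mul_le_mul_of_nonneg_left (Finset.sum_le_sum fun x _ => ?_) (by positivity)
  exact Summable.tsum_le_tsum (fun y => lennardJones_le_chi_mul _)
    (Q.summable_lennardJones_dist_three x) (summable_chi_mul_dist Q x)

/-- **Periodic stability of `V_χ = min 1 (max 0 (4 − 2r)) · V_LJ`**: the energies per particle of periodic configurations of `ℝ³` are bounded below (so the crux's `e_χ* = ⨅ e_χ` is a genuine infimum). [folklore] -/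
theorem stub_periodicStability :
    BddBelow (Set.range fun Q : PeriodicConfiguration 3 =>
      Q.energyPerParticle fun r => min 1 (max 0 (4 - 2 * r)) * lennardJones r) :=
  ⟨-(65536 ^ 2 / 12 : ℝ), by
    rintro _ ⟨Q, rfl⟩
    exact (ChargedEnergyGapNegative.Blocks.neg_le_energyPerParticle Q).trans
      (energyPerParticle_lennardJones_le Q)⟩

end Summit.AtomisticToContinuum.Crystallization.Theorems.PricedLinkCensusTruncatedCensusGap

end
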